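import Literature.NumberTheory.NumberFields.RayClassFieldAdicCharacterDecomposition
import Literature.NumberTheory.GaloisRepresentations.WeilGroupDensityProofs
import HarnessLib

/-!
# THE LOCAL TOWER CONTAINS THE GLOBAL ONE: `ι(K(𝔪v^{n+1})) ⊆ E·K_π^{n+1}` in `K̄_v` for the ABSOLUTE Lubin–Tate model
# `π^f = α` (`(α) = 𝔭_v^f`, `α ≡ 1 mod 𝔪`) over an unramified base `E` with `f ∣ f_E` — de Shalit II.1.10 / I.1.8 at the split prime

For `K` totally complex, `𝔪 ≠ 0`, `v ∤ 𝔪`, `w_𝔪 = 1`, the `𝔭`-division tower `K(𝔪𝔭^{n+1})` completed at a prime `𝔓 ∣ 𝔭 = v`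
is de Shalit's local tower `k_ξ^{n+1}` of the relative Lubin–Tate group of type `ξ = α = φ(𝔭^f)` over `Φ = K(𝔪)_𝔓`
(II.1.10 Lemma; I.1.8: class field to `⟨ξ⟩·(1 + 𝔭^{n+1})`).  When `ξ = π^f` for a uniformiser `π` of `K_v` (the
ABSOLUTE model of the tree's Coleman theory, e.g. `π = ψ(𝔭)` for `K = ℚ(√−7)` — memo
`Cruxes/TwoVariableMainConjAtSplitTwoQuad/LOCAL-TOWER-TYPE-w4g9.md`), that tower is `E·K_π^{n+1}` (`E ⊔ ltField π n`) for
every unramified `E ⊇ Φ` with `f ∣ f_E`.  THIS file proves the containment in the kernel, in two forms: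

* §1 (Galois form) ★ `absGaloisRestrict_toAbsGalois_mem_ker_rayClassField_mul_pow_of_mem_fixingSubgroup` — for a local Weil
  element `w` with `f ∣ deg w` fixing `K_π^{n+1}` pointwise, **`res w` fixes `K(𝔪v^{n+1})`**.  Proof: `w = w₁·Φ^{-deg w}` with
  `Art(Φ) = π` (`Φ` fixes every `K_π^{n+1}`), `w₁ ∈ I_{K_v}` fixing `K_π^{n+1}`, so `Art(w₁) = χ_π(w₁) ≡ 1 mod π^{n+1}` and
  `[⟨Art w₁⟩_v, K]` fixes `K(𝔪v^{n+1})` (local–global compatibility + `W_{𝔪v^{n+1}}`), while `Art(Φ^f) = π^f = α_v` makes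
  `res(Φ^f)` fix every `K(𝔪v^{m})` (the Frobenius clause of `RayClassFieldAdicCharacterDecomposition.lean`).
* §2 (field form) ★ `absClosureEmbedding_mem_sup_ltField_of_mem_rayClassField_mul_pow` — for `E ≤ maxUnramified K_v` finite
  normal with `f ∣ deg w` for every Weil element fixing `E` (e.g. `f ∣ f_E`, tree `inertiaDeg_dvd_deg_of_mem_fieldSubgroup`):
  **`ι(x) ∈ E ⊔ ltField π n` for every `x ∈ K(𝔪v^{n+1})`**, `ι = absClosureEmbedding K K_v : K̄ → K̄_v` (density of
  `W_{K_v}` in `Γ_{K_v}` + the Galois correspondence for the finite Galois extension `E·K_π^{n+1}/K_v`).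

So the semi-local elliptic units of modulus `𝔪` (elements of `K(𝔪𝔭^{n+1})`) land, at `𝔓`, inside the tower of the tree's
`RelNormCoherentUnits hπ E` — the field-theoretic input of brick B2/B5.  Theorems only; no `sorry`.

## References
* [deShalit1987] E. de Shalit, *Iwasawa theory of elliptic curves with complex multiplication* (1987), I.1.8 (p. 11),
  II.1.10 Lemma and Corollary (p. 39), II.4.3–4.5 (p. 57–58).
* [NeukirchANT1999] J. Neukirch, *Algebraic Number Theory* (1999), Ch. VI §5 Prop. (5.6), §7 Thm. (7.1).
* [CasselsFrohlichANT1967] Cassels–Fröhlich (1967), Ch. VI §3.4 Thm. 3 (e), §3.6 Prop. 6, §3.7 Thm. 3.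
* [Corvallis1979] J. Tate, *Number theoretic background* (1979), (1.4.1) (`W_F` dense in `Γ_F`).
-/

noncomputable section

open NumberField IsDedekindDomain IsDedekindDomain.HeightOneSpectrum Field
open scoped nonZeroDivisors Classical

namespace Literature.NumberTheory.NumberFields

open Literature.NumberTheory.GaloisRepresentations
open Literature.NumberTheory.GaloisRepresentations.ArtinLocalGlobal
open Literature.NumberTheory.GaloisRepresentations.IsNonarchimedeanLocalField

variable {K : Type} [Field K] [NumberField K] {𝔪 : Ideal (𝓞 K)} {v : HeightOneSpectrum (𝓞 K)}

/-! ### §0. Local helpers: degrees of powers, the level-`(n+1)` kernel, the valuation of `Art(w₁) − 1` -/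

/-- `deg (Φ ^ k) = k · deg Φ` for `k ∈ ℤ`. [folklore] -/
private theorem deg_zpow (Φ : WeilGroup (v.adicCompletion K)) (k : ℤ) :
    WeilGroup.deg (Φ ^ k) = k * WeilGroup.deg Φ := by
  have h := map_zpow (WeilGroup.degHom (v.adicCompletion K) IsFrobPow.mul_holds IsFrobPow.unique_holds) Φ k
  rw [WeilGroup.degHom_apply, WeilGroup.degHom_apply, ← ofAdd_zsmul, smul_eq_mul] at h
  exact Multiplicative.ofAdd.injective h

open ValuativeRel in
/-- An automorphism fixing `K_π^{n+1}` pointwise lies in the kernel of the level-`(n+1)` character.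
[cite: CasselsFrohlichANT1967, Ch. VI §3.6 Prop. 6 (b)] -/
theorem mem_ker_ltAbsChar_of_mem_fixingSubgroup {π : 𝒪[v.adicCompletion K]}
    (hπ : (valuation (v.adicCompletion K)).IsUniformizer (π : v.adicCompletion K)) (n : ℕ)
    {σ : absoluteGaloisGroup (v.adicCompletion K)} (hσ : σ ∈ (ltField π n).fixingSubgroup) :
    σ ∈ (ltAbsChar hπ n).ker := by
  haveI := isGalois_ltField hπ n
  rw [MonoidHom.mem_ker, ltAbsChar_apply]
  have h1 : AlgEquiv.restrictNormalHom (ltField π n) (Field.absoluteGaloisGroup.toAlgEquiv _ σ) = 1 := by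
    ext x
    rw [AlgEquiv.restrictNormalHom_apply, AlgEquiv.one_apply]
    exact (IntermediateField.mem_fixingSubgroup_iff _ _).mp hσ x x.2
  rw [h1, map_one]

open ValuativeRel in
/-- **`|Art(w₁) − 1|_v ≤ |v^{n+1}|`** for an inertia element `w₁` fixing `K_π^{n+1}` (`Art(w₁) = χ_π(w₁) ≡ 1 mod π^{n+1}`,
Lubin–Tate reciprocity with THE Artin map). [cite: LubinTate1965, Thm. 3] [cite: CasselsFrohlichANT1967, Ch. VI §3.7 Thm. 3] -/
theorem valued_canonicalArtin_sub_one_le_of_mem_fixingSubgroup {π : 𝒪[v.adicCompletion K]}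
    (hπ : (valuation (v.adicCompletion K)).IsUniformizer (π : v.adicCompletion K)) (n : ℕ)
    {w₁ : WeilGroup (v.adicCompletion K)} (hw₁ : w₁ ∈ WeilGroup.inertia (v.adicCompletion K))
    (hfix : WeilGroup.toAbsGalois (v.adicCompletion K) w₁ ∈ (ltField π n).fixingSubgroup) :
    Valued.v (((canonicalArtin (v.adicCompletion K) w₁ : (v.adicCompletion K)ˣ) : v.adicCompletion K) - 1) ≤
      WithZero.exp (-((n + 1 : ℕ) : ℤ)) := by
  obtain ⟨y, hy⟩ := pow_dvd_lubinTateChar_sub_one hπ (mem_ker_ltAbsChar_of_mem_fixingSubgroup hπ n hfix)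
  have hart : (((canonicalArtin (v.adicCompletion K) w₁ : (v.adicCompletion K)ˣ) : v.adicCompletion K) - 1) =
      (π : v.adicCompletion K) ^ (n + 1) * (y : v.adicCompletion K) := by
    rw [← coe_lubinTateChar_toAbsGalois_canonicalArtin hπ hw₁]
    have h := congrArg (fun z : 𝒪[v.adicCompletion K] ↦ (z : v.adicCompletion K)) hy
    simpa using h
  rw [hart, Valuation.map_mul, Valuation.map_pow, valued_eq_exp_neg_one_of_isUniformizer v hπ]
  have hy1 : Valued.v (y : v.adicCompletion K) ≤ 1 :=
    ((ValuativeRel.isEquiv (Valued.v : Valuation (v.adicCompletion K) (WithZero (Multiplicative ℤ)))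
      (valuation (v.adicCompletion K))).le_one_iff_le_one).mpr y.2
  calc WithZero.exp (-1 : ℤ) ^ (n + 1) * Valued.v (y : v.adicCompletion K)
      ≤ WithZero.exp (-1 : ℤ) ^ (n + 1) * 1 := by gcongr
    _ = WithZero.exp (-((n + 1 : ℕ) : ℤ)) := by rw [mul_one, ← WithZero.exp_nsmul]; congr 1; simp

/-! ### §1. Galois form: `w` fixes `K_π^{n+1}` and `f ∣ deg w` ⟹ `res w` fixes `K(𝔪v^{n+1})` -/

variable [IsTotallyComplex K]

open ValuativeRel in
/-- ★ **THE LOCAL TOWER CONTAINS THE GLOBAL ONE, Galois form.** Let `π` be a uniformiser of `K_v` and `α ∈ 𝓞_K` with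
`α ≠ 0`, `α ≡ 1 mod 𝔪`, `α` a unit at every finite place `≠ v`, and `α = π^f` in `K_v` (the absolute model). For every
local Weil element `w` with `f ∣ deg w` that fixes `K_π^{n+1}` pointwise, `res w ∈ Gal(K̄/K(𝔪v^{n+1}))`.
[cite: deShalit1987, I.1.8 (p. 11), II.1.10 (p. 39)] [cite: NeukirchANT1999, Ch. VI §5 Prop. (5.6)]
[cite: CasselsFrohlichANT1967, Ch. VI §3.4 Thm. 3 (e), §3.7 Thm. 3] -/
theorem absGaloisRestrict_toAbsGalois_mem_ker_rayClassField_mul_pow_of_mem_fixingSubgroup (h𝔪 : 𝔪 ≠ ⊥)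
    (hv : ¬ 𝔪 ≤ v.asIdeal) {π : 𝒪[v.adicCompletion K]}
    (hπ : (valuation (v.adicCompletion K)).IsUniformizer (π : v.adicCompletion K))
    {α : 𝓞 K} (hα0 : α ≠ 0) (hα𝔪 : α - 1 ∈ 𝔪) (hαw : ∀ w : HeightOneSpectrum (𝓞 K), w ≠ v → α ∉ w.asIdeal)
    {f : ℕ} (hαπ : ((α : K) : v.adicCompletion K) = (π : v.adicCompletion K) ^ f)
    (n : ℕ) (w : WeilGroup (v.adicCompletion K)) (hdeg : (f : ℤ) ∣ WeilGroup.deg w)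
    (hfix : WeilGroup.toAbsGalois (v.adicCompletion K) w ∈ (ltField π n).fixingSubgroup) :
    absGaloisRestrict K (v.adicCompletion K) (WeilGroup.toAbsGalois (v.adicCompletion K) w) ∈
      (absRestrictNormalHom (rayClassField K (𝔪 * v.asIdeal ^ (n + 1)))).ker := by
  have ha := isLocalArtinMap_canonicalArtin_holds (v.adicCompletion K)
  have h𝔑0 : 𝔪 * v.asIdeal ^ (n + 1) ≠ ⊥ := mul_ne_zero h𝔪 (pow_ne_zero _ v.ne_bot)
  -- a Frobenius `Φ` for `π`: `deg Φ = -1`, `Art Φ = π`; it fixes every `K_π^{m+1}`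
  obtain ⟨Φ, hΦdeg, hΦart⟩ := exists_deg_eq_neg_one_artin_eq ha
    (x := Units.mk0 (π : v.adicCompletion K) hπ.ne_zero) hπ
  have hΦfix : WeilGroup.toAbsGalois (v.adicCompletion K) Φ ∈ (ltField π n).fixingSubgroup :=
    toAbsGalois_mem_fixingSubgroup_ltField hπ ha hΦart n
  -- `w₁ := w · Φ^{deg w}` is an inertia element fixing `K_π^{n+1}`
  obtain ⟨j, hj⟩ := hdeg
  set d := WeilGroup.deg w with hd
  have hdeg₁ : WeilGroup.deg (w * Φ ^ d) = 0 := by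
    rw [WeilGroup.deg_mul IsFrobPow.mul_holds IsFrobPow.unique_holds, deg_zpow, hΦdeg]; ring
  have hw₁ : w * Φ ^ d ∈ WeilGroup.inertia (v.adicCompletion K) :=
    (WeilGroup.deg_eq_zero_iff_mem_inertia IsFrobPow.mul_holds IsFrobPow.unique_holds).mp hdeg₁
  have hw₁fix : WeilGroup.toAbsGalois (v.adicCompletion K) (w * Φ ^ d) ∈ (ltField π n).fixingSubgroup := by
    rw [map_mul, map_zpow]
    exact Subgroup.mul_mem _ hfix (Subgroup.zpow_mem _ hΦfix d)
  -- `res w₁` fixes `K(𝔪v^{n+1})`: it acts as `[⟨u⁻¹⟩_v, K]` with `|u − 1| ≤ |v^{n+1}|`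
  obtain ⟨u, hu⟩ := exists_unitsMap_eq_artin_of_mem_inertia ha hw₁
  have hval : Valued.v ((((u⁻¹ : (v.adicCompletionIntegers K)ˣ) : v.adicCompletionIntegers K) :
      v.adicCompletion K) - 1) ≤ WithZero.exp (-((n + 1 : ℕ) : ℤ)) := by
    have h1 := valued_canonicalArtin_sub_one_le_of_mem_fixingSubgroup hπ n hw₁ hw₁fix
    rw [← hu] at h1
    have hcoe : ((Units.map ((v.adicCompletionIntegers K).subtype : _ →* _) u : (v.adicCompletion K)ˣ) :
        v.adicCompletion K) = ((u : v.adicCompletionIntegers K) : v.adicCompletion K) := rfl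
    rw [hcoe] at h1
    -- `|u⁻¹ − 1| = |u|⁻¹ |1 − u| = |u − 1|`
    have hu1 : Valued.v (((u : v.adicCompletionIntegers K) : v.adicCompletion K)) = 1 :=
      adicCompletionIntegers.isUnit_iff_valued_eq_one.mp (Units.isUnit u)
    have hne : ((u : v.adicCompletionIntegers K) : v.adicCompletion K) ≠ 0 := fun h0 ↦ by
      rw [h0, map_zero] at hu1; exact zero_ne_one hu1
    have heq : ((((u⁻¹ : (v.adicCompletionIntegers K)ˣ) : v.adicCompletionIntegers K) : v.adicCompletion K) - 1) =
        (((u : v.adicCompletionIntegers K) : v.adicCompletion K))⁻¹ *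
          -(((u : v.adicCompletionIntegers K) : v.adicCompletion K) - 1) := by
      have hinv : ((((u⁻¹ : (v.adicCompletionIntegers K)ˣ) : v.adicCompletionIntegers K) : v.adicCompletion K)) =
          (((u : v.adicCompletionIntegers K) : v.adicCompletion K))⁻¹ := by
        exact eq_inv_of_mul_eq_one_left (by
          rw [← MulMemClass.coe_mul, ← Units.val_mul, inv_mul_cancel, Units.val_one, OneMemClass.coe_one])
      rw [hinv]; field_simp; ring
    rw [heq, Valuation.map_mul, Valuation.map_neg, map_inv₀, hu1, inv_one, one_mul]
    exact h1
  have hmem₁ : absGaloisRestrict K (v.adicCompletion K) (WeilGroup.toAbsGalois (v.adicCompletion K) (w * Φ ^ d)) ∈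
      (absRestrictNormalHom (rayClassField K (𝔪 * v.asIdeal ^ (n + 1)))).ker := by
    rw [MonoidHom.mem_ker, isAdicArtinValue_inv_of_mem_inertia ha (w * Φ ^ d) hu (n + 1),
      abRestrict_ideleArtinMap_rayClassField_eq_one_iff]
    exact Subgroup.mem_sup_right ((localUnits_integer_mem_rayUnitIdeles_mul_pow_iff h𝔪 hv (n + 1) u⁻¹).mpr hval)
  -- `res (Φ^f)` fixes `K(𝔪v^{n+1})`: `Art(Φ^f) = π^f = α_v` (Frobenius clause)
  have hΦf : canonicalArtin (v.adicCompletion K) (Φ ^ f) =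
      Units.mk0 ((α : K) : v.adicCompletion K) (by
        rw [← algebraMap_adicCompletion_apply, map_ne_zero_iff _ (algebraMap K (v.adicCompletion K)).injective]
        exact_mod_cast hα0) *
        Units.map ((v.adicCompletionIntegers K).subtype : v.adicCompletionIntegers K →* v.adicCompletion K)
          (1 : (v.adicCompletionIntegers K)ˣ) := by
    rw [map_one, mul_one, map_pow, hΦart]
    exact Units.ext (by rw [Units.val_pow_eq_pow_val, Units.val_mk0, Units.val_mk0, hαπ])
  have hmemf : absGaloisRestrict K (v.adicCompletion K) (WeilGroup.toAbsGalois (v.adicCompletion K) (Φ ^ f)) ∈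
      (absRestrictNormalHom (rayClassField K (𝔪 * v.asIdeal ^ (n + 1)))).ker := by
    rw [MonoidHom.mem_ker, absRestrictNormalHom_absGaloisRestrict_eq_of_artin_eq_mul h𝔑0
      (fun _ hwv ↦ modulusExp_mul_pow_of_ne h𝔪 (n + 1) hwv) ha hα0 hα𝔪 hαw (Φ ^ f) hΦf, inv_one, map_one, map_one,
      map_one, map_one]
  -- assemble: `w = w₁ · (Φ^f)^{-j}`
  have hw : w = (w * Φ ^ d) * ((Φ ^ f) ^ j)⁻¹ := by
    rw [← zpow_natCast, ← zpow_mul, ← hj, mul_inv_cancel_right]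
  rw [hw, map_mul, map_mul, map_inv, map_inv, map_zpow, map_zpow]
  exact Subgroup.mul_mem _ hmem₁ (Subgroup.inv_mem _ (Subgroup.zpow_mem _ hmemf j))

/-! ### §2. Field form: `ι(K(𝔪v^{n+1})) ⊆ E ⊔ ltField π n` -/

omit [NumberField K] [IsTotallyComplex K] in
/-- `((τ|_L) x : K̄) = τ • x`. [folklore] -/
private theorem coe_absRestrictNormalHom_apply₉ (L : IntermediateField K (AlgebraicClosure K)) [Normal K L]
    (τ : absoluteGaloisGroup K) (x : L) :
    ((absRestrictNormalHom L τ x : L) : AlgebraicClosure K) = τ • (x : AlgebraicClosure K) :=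
  AlgEquiv.restrictNormalHom_apply L _ x

omit [NumberField K] [IsTotallyComplex K] in
/-- An element of `ker (res_L)` fixes `L` pointwise. [folklore] -/
private theorem smul_eq_of_mem_ker_absRestrictNormalHom₉ (L : IntermediateField K (AlgebraicClosure K)) [Normal K L]
    {τ : absoluteGaloisGroup K} (hτ : τ ∈ (absRestrictNormalHom L).ker) {x : AlgebraicClosure K} (hx : x ∈ L) :
    τ • x = x := by
  rw [MonoidHom.mem_ker] at hτ
  rw [← coe_absRestrictNormalHom_apply₉ L τ ⟨x, hx⟩, hτ, AlgEquiv.one_apply]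

open ValuativeRel in
/-- ★ **THE LOCAL TOWER CONTAINS THE GLOBAL ONE, field form**: with `π`, `α = π^f` as in §1 and a finite normal base `E`
of `K̄_v/K_v` such that `f ∣ deg w` for every local Weil element `w` fixing `E` (for `E ≤ K_v^{nr}` unramified this is
`f ∣ f_E`: tree `inertiaDeg_dvd_deg_of_mem_fieldSubgroup`), every element of `K(𝔪v^{n+1})` lands, under
`ι : K̄ → K̄_v` (`absClosureEmbedding`), in the local tower `E·K_π^{n+1} = E ⊔ ltField π n` — de Shalit's
`K(𝔣𝔭^{n+1})_𝔓 ⊆ Φ·k_ξ^{n+1}` for the absolute type `ξ = π^f` (density of `W_{K_v}` in `Γ_{K_v}` + the Galois correspondence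
for the finite Galois extension `E·K_π^{n+1}/K_v`). [cite: deShalit1987, II.1.10 Lemma (p. 39), II.4.5 (p. 58), I.1.8 (p. 11)]
[cite: Corvallis1979, (1.4.1)] [cite: CasselsFrohlichANT1967, Ch. VI §3.6 Prop. 6] -/
theorem absClosureEmbedding_mem_sup_ltField_of_mem_rayClassField_mul_pow (h𝔪 : 𝔪 ≠ ⊥) (hv : ¬ 𝔪 ≤ v.asIdeal)
    {π : 𝒪[v.adicCompletion K]} (hπ : (valuation (v.adicCompletion K)).IsUniformizer (π : v.adicCompletion K))
    {α : 𝓞 K} (hα0 : α ≠ 0) (hα𝔪 : α - 1 ∈ 𝔪) (hαw : ∀ w : HeightOneSpectrum (𝓞 K), w ≠ v → α ∉ w.asIdeal)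
    {f : ℕ} (hαπ : ((α : K) : v.adicCompletion K) = (π : v.adicCompletion K) ^ f)
    (E : IntermediateField (v.adicCompletion K) (AlgebraicClosure (v.adicCompletion K)))
    [FiniteDimensional (v.adicCompletion K) E] [Normal (v.adicCompletion K) E]
    (hdegE : ∀ w : WeilGroup (v.adicCompletion K),
      WeilGroup.toAbsGalois (v.adicCompletion K) w ∈ E.fixingSubgroup → (f : ℤ) ∣ WeilGroup.deg w)
    (n : ℕ) {x : AlgebraicClosure K} (hx : x ∈ rayClassField K (𝔪 * v.asIdeal ^ (n + 1))) :
    absClosureEmbedding K (v.adicCompletion K) x ∈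
      (E ⊔ ltField π n : IntermediateField (v.adicCompletion K) (AlgebraicClosure (v.adicCompletion K))) := by
  haveI : FiniteDimensional (v.adicCompletion K)
      (E ⊔ ltField π n : IntermediateField (v.adicCompletion K) (AlgebraicClosure (v.adicCompletion K))) :=
    IntermediateField.finiteDimensional_sup E (ltField π n)
  haveI := isGalois_ltField hπ n
  haveI : Normal (v.adicCompletion K)
      (E ⊔ ltField π n : IntermediateField (v.adicCompletion K) (AlgebraicClosure (v.adicCompletion K))) :=
    inferInstance
  -- every `τ ∈ Gal(K̄_v/K_v)` fixing `E ⊔ K_π^{n+1}` fixes `ι x`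
  have key : ∀ τ : AlgebraicClosure (v.adicCompletion K) ≃ₐ[v.adicCompletion K] AlgebraicClosure (v.adicCompletion K),
      τ ∈ (E ⊔ ltField π n : IntermediateField (v.adicCompletion K) (AlgebraicClosure (v.adicCompletion K))).fixingSubgroup →
        τ (absClosureEmbedding K (v.adicCompletion K) x) = absClosureEmbedding K (v.adicCompletion K) x := by
    -- the stabiliser of `ι x` is an open, hence closed, subgroup; the Weil elements fixing `E ⊔ K_π^{n+1}` fix `ι x`
    -- (Galois form), and `W_{K_v}` is dense in `Γ_{K_v}`
    by_contra hcon
    push Not at hcon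
    obtain ⟨τ₀, hτ₀L, hτ₀x⟩ := hcon
    haveI : FiniteDimensional (v.adicCompletion K)
        (IntermediateField.adjoin (v.adicCompletion K) {absClosureEmbedding K (v.adicCompletion K) x}) :=
      IntermediateField.adjoin.finiteDimensional (Algebra.IsIntegral.isIntegral _)
    have hstab : IsOpen ((MulAction.stabilizer
        (AlgebraicClosure (v.adicCompletion K) ≃ₐ[v.adicCompletion K] AlgebraicClosure (v.adicCompletion K))
        (absClosureEmbedding K (v.adicCompletion K) x) : Subgroup _) :
          Set (AlgebraicClosure (v.adicCompletion K) ≃ₐ[v.adicCompletion K] AlgebraicClosure (v.adicCompletion K))) := by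
      refine Subgroup.isOpen_mono (H₁ := (IntermediateField.adjoin (v.adicCompletion K)
        {absClosureEmbedding K (v.adicCompletion K) x}).fixingSubgroup) (fun τ hτ ↦ ?_)
        (IntermediateField.fixingSubgroup_isOpen _)
      exact (IntermediateField.mem_fixingSubgroup_iff _ _).mp hτ _ (IntermediateField.mem_adjoin_simple_self _ _)
    have hclosed := Subgroup.isClosed_of_isOpen _ hstab
    have hopen : IsOpen ((((E ⊔ ltField π n : IntermediateField (v.adicCompletion K)
        (AlgebraicClosure (v.adicCompletion K))).fixingSubgroup :
          Set (AlgebraicClosure (v.adicCompletion K) ≃ₐ[v.adicCompletion K] AlgebraicClosure (v.adicCompletion K)))) ∩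
        ((MulAction.stabilizer
          (AlgebraicClosure (v.adicCompletion K) ≃ₐ[v.adicCompletion K] AlgebraicClosure (v.adicCompletion K))
          (absClosureEmbedding K (v.adicCompletion K) x) : Subgroup _) :
            Set (AlgebraicClosure (v.adicCompletion K) ≃ₐ[v.adicCompletion K] AlgebraicClosure (v.adicCompletion K)))ᶜ) :=
      (IntermediateField.fixingSubgroup_isOpen _).inter hclosed.isOpen_compl
    have hd0 := WeilGroup.denseRange_toAbsGalois_holds (v.adicCompletion K)
    dsimp only [WeilGroup.denseRange_toAbsGalois] at hd0
    have hd : DenseRange (fun w : WeilGroup (v.adicCompletion K) ↦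
        absoluteGaloisGroup.toAlgEquiv (v.adicCompletion K) (WeilGroup.toAbsGalois (v.adicCompletion K) w)) := hd0
    obtain ⟨w, hwL, hwx⟩ := hd.exists_mem_open hopen ⟨τ₀, hτ₀L, fun h ↦ hτ₀x (MulAction.mem_stabilizer_iff.mp h)⟩
    apply hwx
    rw [SetLike.mem_coe, MulAction.mem_stabilizer_iff]
    -- `w` fixes `E` and `K_π^{n+1}`
    have hwE : WeilGroup.toAbsGalois (v.adicCompletion K) w ∈ E.fixingSubgroup :=
      (IntermediateField.mem_fixingSubgroup_iff _ _).mpr fun y hy ↦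
        (IntermediateField.mem_fixingSubgroup_iff _ _).mp hwL y
          ((le_sup_left : E ≤ E ⊔ ltField π n) hy)
    have hwπ : WeilGroup.toAbsGalois (v.adicCompletion K) w ∈ (ltField π n).fixingSubgroup :=
      (IntermediateField.mem_fixingSubgroup_iff _ _).mpr fun y hy ↦
        (IntermediateField.mem_fixingSubgroup_iff _ _).mp hwL y
          ((le_sup_right : ltField π n ≤ E ⊔ ltField π n) hy)
    have hker := absGaloisRestrict_toAbsGalois_mem_ker_rayClassField_mul_pow_of_mem_fixingSubgroup h𝔪 hv hπ hα0 hα𝔪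
      hαw hαπ n w (hdegE w hwE) hwπ
    change WeilGroup.toAbsGalois (v.adicCompletion K) w • absClosureEmbedding K (v.adicCompletion K) x = _
    rw [← absGaloisRestrict_apply_smul, smul_eq_of_mem_ker_absRestrictNormalHom₉ _ hker hx]
  -- Galois correspondence for the finite Galois extension `E ⊔ K_π^{n+1}`
  haveI : CharZero (v.adicCompletion K) :=
    charZero_of_injective_algebraMap (algebraMap K (v.adicCompletion K)).injective
  haveI : IsGalois (v.adicCompletion K) (AlgebraicClosure (v.adicCompletion K)) :=
    IsAlgClosure.isGalois (v.adicCompletion K) (AlgebraicClosure (v.adicCompletion K))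
  have hfix : absClosureEmbedding K (v.adicCompletion K) x ∈ IntermediateField.fixedField
      (E ⊔ ltField π n : IntermediateField (v.adicCompletion K) (AlgebraicClosure (v.adicCompletion K))).fixingSubgroup :=
    (IntermediateField.mem_fixedField_iff _ _).mpr fun τ hτ ↦ key τ hτ
  rwa [InfiniteGalois.fixedField_fixingSubgroup] at hfix

end Literature.NumberTheory.NumberFields

end
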